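import Summits.QuantumFields.BalabanUV.Beta.GAN24.KernelPeriodisation
import Summits.QuantumFields.BalabanUV.Beta.GAN24.DirichletExhaustionCoerDict
import Literature.MathematicalPhysics.QuantumFieldTheory.Balaban1983to89.B6Cov2156TorusDelK

/-!
# G-an2-4 ∕ (CONV-C), route R7, junction (S)(α) — PART B: pv09's TORUS ELIMINATION `C = elimT L M` (p. 250) IS THE PERIODISATION OF ROAD P2's
# `ℤ^{d+1}` ELIMINATION `elimZ L`; the torus average's multiplicity IS the periodised `ℤ^{d+1}` multiplicity; `Δ_T = per Δ_Z` re-read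

G-an2-4 formalisation swarm `b2b-balaban-gan24-formalise-*`, leaf prover 06 (gen 40), CRUX TEAM (2), ruling «YM REDIRECT» (e34b3e0c; FREEZE (0)
honoured; INTENT «STEP-COVARIANCE-PERIODISE», HOME/CLAIMS.log 2026-08-21 l.34155).  The two typings of Bałaban's `U = 1` step covariance
`C(C*Δ_kC)⁻¹C*` ([Balaban1984PropagatorsII] (2.156) p. 250) in the tree — road P2's on the bond index set of `ℤ^{d+1}` (`DirichletExhaustionElimZ.elimZ L`,
`DirichletExhaustionDeltaZ.deltaZ L k`, free bonds `IsFreeZ L`) and pv09's on the torus box (`B6Cov2156Torus.elimT L M`, `freeT L M`, `reDelK (L^k) _ M`)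
— are related by PART A's periodisation map `per M`.  THIS PART proves the object-level dictionary (0 sorry, 0 def, no cited fact):
 * §1 ON THE BOX THE BOND CLASSES AGREE (`L ∣ M_i`): `isTree_iff_isTreeZ` (pv09∕b06's torus tree bonds = road P2's, the corner of a box point is a
   coarse site — `B6Lemma24Torus.corner_mem_coarseSites`), `mem_faces_iff_isPivZ` (the pivot's coarse bond lies in the box: a multiple of `L` above
   `−L` is `≥ 0`), `mem_freeT_iff : q ∈ freeT L M ↔ IsFreeZ L q̃`;
 * §2 INVARIANCE under the period lattice (`L ∣ M_i`, so `Mℤ^{d+1} ⊆ Lℤ^{d+1}`): `isTreeZ_sh_iff` (road P2's `isTreeZ_add_iff`), `isPivZ_sh_iff`,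
   `isFreeZ_sh_iff`, `cOf_sh`, `mult_sh` (road P2's `mult_translate`), **`elimZ_sh`**, `deltaZ_sh`;
 * §3 **`multP_eq_tsum_mult : (multP L M c z ν : ℝ) = Σ'_m mult L c (z + M∘m) ν`** for a box point `z` — pv09's PERIODIC multiplicity of the torus
   average ([B6] (2.125) read on the torus, WITH wrapping) is the periodisation of b06's `ℤ^{d+1}` multiplicity (fibrewise count over PART A's
   quotient coordinates; complement of the road-P2 chair's off-seam `DirichletExhaustionCoerDict.multP_eq_mult`, p199502);
 * §4 **`per_elimZ : per M (elimZ L) p q = if h : q ∈ freeT L M then elimT L M p ⟨q, h⟩ else 0`** — pv09's explicit torus `C` of p. 250 IS the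
   periodisation of road P2's `elimZ L` (zero columns off the free bonds);
 * §5 `per_deltaZ : per M (deltaZ L k) = deltaPol M (L^k)` (the chair's `deltaPol_eq_tsum_deltaZ` p-accepted, re-read in PART A's notation) and
   `per_deltaZ_eq_reDelK` (pv09's junction `deltaPol_eq_reDelK`): `Δ_T = per Δ_Z` for the genuine (1.65) operator.
HONEST SCOPE.  [folklore] bond combinatorics over b06 ∕ pv09 ∕ road-P2 definitions BY NAME; `U = 1`; nothing printed enters as a hypothesis (ABSOLUTE
RULE); [Balaban1984PropagatorsII] pp. 249–250 is a TEXT LOCATION.  Moves NO (CONV-C) clause; NOT (CONV-C) as typed, NEVER «G-an2-4 closed», NOT NE2 ∕ NE3,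
NOT D1, NOT BetaPertH, NOT continuum, NOT Clay — not in print; our bookkeeping.  HONEST DEPENDENCY: continuum YM on T⁴ ⇐ BetaPertH ∧ nine spine
estimates (0/9 proved); BetaPertH ⇐ (D1) ∧ (D4) ∧ CAP+tail; G-an2-4 gates asym, D1 and NE2/3/4.
-/

noncomputable section

open scoped BigOperators
open Finset Real

namespace Summit.QuantumFields.BalabanUV.Beta.GAN24.ElimPeriodise

open Literature.MathematicalPhysics.QuantumFieldTheory.Balaban1983to89
open B4Sect5Exhaustion (K)
open B4TorusKernel.MultiPeriod (translate)
open B6Elimination (corner)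
open B6BondElimination (unitVec add_smul_unitVec_apply cOf cOf_fst_apply mult hits mem_hits IsTree mem_freeB)
open B6Lemma24Torus (pbox mem_pbox coarseSites mem_coarseSites faces mem_faces wrap corner_mem_coarseSites)
open B6Cov2156Torus (hitsP mem_hitsP multP freeT elimT elimT_apply deltaPol)
open B6Cov2156TorusDelK (reDelK deltaPol_eq_reDelK)
open Summit.QuantumFields.BalabanUV.Beta.GAN24.DirichletExhaustionQuadForm (amb)
open Summit.QuantumFields.BalabanUV.Beta.GAN24.DirichletExhaustionDeltaZ (deltaZ)
open Summit.QuantumFields.BalabanUV.Beta.GAN24.DirichletExhaustionElimZ (IsTreeZ IsPivZ IsFreeZ elimZ elimZ_of_not_free)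
open Summit.QuantumFields.BalabanUV.Beta.GAN24.DirichletExhaustionCoerDict (isTreeZ_add_iff mult_translate isTreeZ_of_isTree)
open Summit.QuantumFields.BalabanUV.Beta.GAN24.DirichletExhaustionPeriodise (deltaPol_eq_tsum_deltaZ)
open Summit.QuantumFields.BalabanUV.Beta.GAN24.KernelPeriodisation (sh sh_fst sh_snd sh_eq_sh_iff quo wrap_translate quo_translate
  translate_wrap_quo per per_apply amb_eq_sh_iff tsum_ite_amb_eq_sh)

variable {d : ℕ} {L : ℕ} (M : Fin (d + 1) → ℕ) [∀ μ, NeZero (M μ)]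

/-! ## §1 On the box the bond classes of the two typings agree -/

omit [∀ μ, NeZero (M μ)] in
/-- **torus tree bonds = `ℤ^{d+1}` tree bonds** on the box (the corner of a box point is a coarse site of the torus). [folklore] -/
theorem isTree_iff_isTreeZ (hL : 0 < L) (p : B4.Idx (pbox M) (d + 1)) : IsTree L (coarseSites L M) p ↔ IsTreeZ L (amb p) :=
  ⟨isTreeZ_of_isTree, fun h => ⟨corner_mem_coarseSites hL p.1.2, h.1, h.2⟩⟩

omit [∀ μ, NeZero (M μ)] in
/-- **«the coarse bond of `p` is a face of the torus» = «`p̃` is a pivot of `ℤ^{d+1}`»** on the box: if every coordinate of `c₋ = p₋ − (L−1)e_μ` is a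
multiple of `L` then `c₋` lies in the box (a multiple of `L` above `−L` is `≥ 0`). [folklore] -/
theorem mem_faces_iff_isPivZ (hL : 0 < L) (p : B4.Idx (pbox M) (d + 1)) :
    cOf L (p.1 : Fin (d + 1) → ℤ) p.2 ∈ faces L M ↔ IsPivZ L (amb p) := by
  rw [mem_faces, mem_coarseSites]
  refine ⟨fun h => h.2, fun h => ⟨mem_pbox.2 fun i => ?_, h⟩⟩
  obtain ⟨h0, h1⟩ := mem_pbox.1 p.1.2 i
  have hL' : (0 : ℤ) < L := by exact_mod_cast hL
  obtain ⟨k, hk⟩ := h i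
  have hk' : (cOf L (p.1 : Fin (d + 1) → ℤ) p.2).1 i = (L : ℤ) * k := hk
  rw [cOf_fst_apply] at hk' ⊢
  split_ifs at hk' ⊢ with hi
  · have hk0 : 0 ≤ k := by
      by_contra hneg
      push Not at hneg
      have : (L : ℤ) * k ≤ (L : ℤ) * (-1) := mul_le_mul_of_nonneg_left (by omega) hL'.le
      linarith
    constructor
    · rw [hk']; positivity
    · linarith
  · exact ⟨by linarith, by linarith⟩

omit [∀ μ, NeZero (M μ)] in
/-- **pv09's remaining variables = road P2's free bonds** on the box: `q ∈ freeT L M ↔ IsFreeZ L q̃`. [folklore] -/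
theorem mem_freeT_iff (hL : 0 < L) (q : B4.Idx (pbox M) (d + 1)) : q ∈ freeT L M ↔ IsFreeZ L (amb q) := by
  rw [mem_freeB, isTree_iff_isTreeZ M hL, mem_faces_iff_isPivZ M hL]
  exact and_comm

/-! ## §2 Invariance of Bałaban's `ℤ^{d+1}` objects under the period lattice (`L ∣ M_i`) -/

section Invariance

variable {M}

omit [∀ μ, NeZero (M μ)] in
/-- the period lattice lies in `Lℤ^{d+1}`. -/
theorem dvd_period (hLM : ∀ i, L ∣ M i) (m : Fin (d + 1) → ℤ) (i : Fin (d + 1)) : (L : ℤ) ∣ (M i : ℤ) * m i :=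
  Dvd.dvd.mul_right (Int.natCast_dvd_natCast.2 (hLM i)) _

omit [∀ μ, NeZero (M μ)] in
/-- a shift is the addition of a period vector. -/
theorem sh_eq_add (m : Fin (d + 1) → ℤ) (s : K (d + 1) (d + 1)) : sh M m s = (s.1 + fun i => (M i : ℤ) * m i, s.2) := rfl

omit [∀ μ, NeZero (M μ)] in
/-- tree bonds are invariant under the period lattice (road P2's `isTreeZ_add_iff`). -/
theorem isTreeZ_sh_iff (hL : 0 < L) (hLM : ∀ i, L ∣ M i) (m : Fin (d + 1) → ℤ) (s : K (d + 1) (d + 1)) :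
    IsTreeZ L (sh M m s) ↔ IsTreeZ L s := by
  rw [sh_eq_add]
  exact isTreeZ_add_iff hL s.1 _ (dvd_period hLM m) s.2

omit [∀ μ, NeZero (M μ)] in
/-- the coarse bond of a shifted bond is the shifted coarse bond. -/
theorem cOf_sh (m : Fin (d + 1) → ℤ) (s : K (d + 1) (d + 1)) :
    cOf L (sh M m s).1 (sh M m s).2 = ((cOf L s.1 s.2).1 + fun i => (M i : ℤ) * m i, s.2) := by
  refine Prod.ext (funext fun i => ?_) rfl
  simp only [cOf_fst_apply, sh_fst, sh_snd, B4TorusKernel.MultiPeriod.translate_apply, Pi.add_apply]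
  ring

omit [∀ μ, NeZero (M μ)] in
/-- pivots are invariant under the period lattice. -/
theorem isPivZ_sh_iff (hLM : ∀ i, L ∣ M i) (m : Fin (d + 1) → ℤ) (s : K (d + 1) (d + 1)) : IsPivZ L (sh M m s) ↔ IsPivZ L s := by
  unfold IsPivZ
  rw [cOf_sh]
  exact forall_congr' fun i => dvd_add_left (dvd_period hLM m i)

omit [∀ μ, NeZero (M μ)] in
/-- free bonds are invariant under the period lattice. -/
theorem isFreeZ_sh_iff (hL : 0 < L) (hLM : ∀ i, L ∣ M i) (m : Fin (d + 1) → ℤ) (s : K (d + 1) (d + 1)) :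
    IsFreeZ L (sh M m s) ↔ IsFreeZ L s := by
  unfold IsFreeZ
  rw [isTreeZ_sh_iff hL hLM, isPivZ_sh_iff hLM]

omit [∀ μ, NeZero (M μ)] in
/-- multiplicities are invariant under simultaneous shifts (road P2's `mult_translate`). -/
theorem mult_sh (m : Fin (d + 1) → ℤ) (p f : K (d + 1) (d + 1)) :
    mult L (cOf L (sh M m p).1 (sh M m p).2) (sh M m f).1 (sh M m f).2 = mult L (cOf L p.1 p.2) f.1 f.2 := by
  rw [cOf_sh]
  exact mult_translate L (cOf L p.1 p.2) f.1 _ f.2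

omit [∀ μ, NeZero (M μ)] in
/-- **road P2's elimination kernel is invariant under the period lattice**: `elimZ L (p + M∘m) (f + M∘m) = elimZ L p f` (`L ∣ M_i`). [folklore] -/
theorem elimZ_sh (hL : 0 < L) (hLM : ∀ i, L ∣ M i) (m : Fin (d + 1) → ℤ) (p f : K (d + 1) (d + 1)) :
    elimZ L (sh M m p) (sh M m f) = elimZ L p f := by
  unfold elimZ
  simp only [isFreeZ_sh_iff hL hLM, isTreeZ_sh_iff hL hLM, isPivZ_sh_iff hLM, sh_eq_sh_iff, mult_sh]

omit [∀ μ, NeZero (M μ)] in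
/-- **road P2's `Δ_k` kernel is invariant under the period lattice** (it is translation invariant). [folklore] -/
theorem deltaZ_sh [NeZero L] (k : ℕ) (m : Fin (d + 1) → ℤ) (p q : K (d + 1) (d + 1)) :
    deltaZ L k (sh M m p) (sh M m q) = deltaZ L k p q := by
  have h : (sh M m p).1 - (sh M m q).1 = p.1 - q.1 := by
    funext i
    simp only [Pi.sub_apply, sh_fst, B4TorusKernel.MultiPeriod.translate_apply]
    ring
  unfold deltaZ
  rw [h, sh_snd, sh_snd]

end Invariance

/-! ## §3 The torus average's multiplicity is the periodised `ℤ^{d+1}` multiplicity -/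

/-- **`multP L M c z ν = Σ'_m mult L c (z + M∘m) ν`** for a box point `z`: the unit bonds `⟨x + se_μ, ·⟩` of the double sum (2.125), reduced into the box,
are counted fibrewise over the quotient coordinates of `x + se_μ` (PART A's `quo`); the fibre over `m` is b06's `hits L c (z + M∘m)`.
[cite: Balaban1984PropagatorsII, (2.125) p.245] [folklore] -/
theorem multP_eq_tsum_mult (c : (Fin (d + 1) → ℤ) × Fin (d + 1)) {z : Fin (d + 1) → ℤ} (hz : z ∈ pbox M) (ν : Fin (d + 1)) :
    (multP L M c z ν : ℝ) = ∑' m : Fin (d + 1) → ℤ, (mult L c (translate M z m) ν : ℝ) := by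
  classical
  by_cases hν : ν = c.2
  swap
  · simp only [multP, mult, if_neg hν, Nat.cast_zero, tsum_zero]
  simp only [multP, mult, if_pos hν]
  set φ : (Fin (d + 1) → ℤ) × ℕ → (Fin (d + 1) → ℤ) := fun xs => quo M (xs.1 + (xs.2 : ℤ) • unitVec c.2) with hφ
  set S : Finset (Fin (d + 1) → ℤ) := (hitsP L M c z).image φ with hS
  -- the fibre of `φ` over `m` inside `hitsP` is `hits L c (z + M∘m)`
  have hfib : ∀ m, (hitsP L M c z).filter (fun xs => φ xs = m) = hits L c (translate M z m) := by
    intro m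
    ext xs
    rw [Finset.mem_filter, mem_hitsP, mem_hits]
    constructor
    · rintro ⟨⟨hbs, hw⟩, hm⟩
      refine ⟨hbs, ?_⟩
      rw [← hm, hφ]
      dsimp only
      rw [← hw]
      exact (translate_wrap_quo M _).symm
    · rintro ⟨hbs, hy⟩
      refine ⟨⟨hbs, ?_⟩, ?_⟩
      · rw [hy]; exact wrap_translate M hz m
      · rw [hφ]; dsimp only; rw [hy]; exact quo_translate M hz m
  -- outside the image the fibres are empty
  have hout : ∀ m ∉ S, hits L c (translate M z m) = ∅ := by
    intro m hm
    rw [← hfib]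
    refine Finset.filter_eq_empty_iff.2 fun xs hxs hxm => hm ?_
    rw [hS, ← hxm]
    exact Finset.mem_image_of_mem φ hxs
  rw [Finset.card_eq_sum_card_fiberwise (f := φ) (t := S) (fun xs hxs => Finset.mem_image_of_mem φ hxs),
    tsum_eq_sum (s := S) (fun m hm => by rw [hout m hm, Finset.card_empty, Nat.cast_zero])]
  push_cast
  exact Finset.sum_congr rfl fun m _ => by rw [hfib]

/-! ## §4 pv09's torus `C` is the periodisation of road P2's `elimZ` -/

/-- **`per_elimZ` — pv09's ELIMINATION MATRIX `C = elimT L M` OF p. 250 ON THE TORUS IS THE PERIODISATION OF ROAD P2's `ℤ^{d+1}` KERNEL `elimZ L`**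
(`L ∣ M_i`): `per M (elimZ L) p q = elimT L M p q` for a remaining variable `q ∈ freeT L M` and `= 0` otherwise (the eliminated variables are not
columns).  Branch by branch: free rows copy (periodised Kronecker), tree rows and non-pivot rows vanish in both typings (§1), and the pivot row of the
face `c` carries `−multP_c∕L = −(Σ'_m mult_c(· + M∘m))∕L` (§3). [cite: Balaban1984PropagatorsII, (2.154)–(2.156) pp.249–250] [folklore] -/
theorem per_elimZ [NeZero L] (hLM : ∀ i, L ∣ M i) (p q : B4.Idx (pbox M) (d + 1)) :
    per M (elimZ L) p q = if hq : q ∈ freeT L M then elimT L M p ⟨q, hq⟩ else 0 := by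
  classical
  have hL : 0 < L := Nat.pos_of_ne_zero (NeZero.ne L)
  rw [per_apply]
  by_cases hq : q ∈ freeT L M
  swap
  · rw [dif_neg hq]
    have hqZ : ¬ IsFreeZ L (amb q) := fun h => hq ((mem_freeT_iff M hL q).2 h)
    have hterm : ∀ m : Fin (d + 1) → ℤ, elimZ L (amb p) (sh M m (amb q)) = 0 := fun m =>
      elimZ_of_not_free fun h => hqZ ((isFreeZ_sh_iff hL hLM m _).1 h)
    simp_rw [hterm, tsum_zero]
  rw [dif_pos hq, elimT_apply]
  have hqZ : IsFreeZ L (amb q) := (mem_freeT_iff M hL q).1 hq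
  have hterm : ∀ m : Fin (d + 1) → ℤ, elimZ L (amb p) (sh M m (amb q)) =
      if amb p = sh M m (amb q) then 1 else if IsTreeZ L (amb p) ∨ ¬ IsPivZ L (amb p) then 0
        else -((mult L (cOf L (amb p).1 (amb p).2) (sh M m (amb q)).1 (sh M m (amb q)).2 : ℝ) / L) := fun m => by
    unfold elimZ
    rw [if_pos ((isFreeZ_sh_iff hL hLM m _).2 hqZ)]
  simp_rw [hterm]
  by_cases hpq : p = q
  · subst hpq
    rw [if_pos rfl]
    have hnp : IsTreeZ L (amb p) ∨ ¬ IsPivZ L (amb p) := Or.inr hqZ.2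
    simp_rw [if_pos hnp]
    rw [tsum_ite_amb_eq_sh M p p, if_pos rfl]
  have hne : ∀ m : Fin (d + 1) → ℤ, amb p ≠ sh M m (amb q) := fun m h => hpq ((amb_eq_sh_iff M).1 h).2
  rw [tsum_congr fun m => if_neg (hne m)]
  have hpq' : p ≠ ((⟨q, hq⟩ : freeT L M) : B4.Idx (pbox M) (d + 1)) := hpq
  rw [if_neg hpq']
  by_cases hbr : IsTree L (coarseSites L M) p ∨ cOf L (p.1 : Fin (d + 1) → ℤ) p.2 ∉ faces L M
  · rw [if_pos hbr]
    have hbrZ : IsTreeZ L (amb p) ∨ ¬ IsPivZ L (amb p) := by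
      rcases hbr with h | h
      · exact Or.inl ((isTree_iff_isTreeZ M hL p).1 h)
      · exact Or.inr fun h' => h ((mem_faces_iff_isPivZ M hL p).2 h')
    simp_rw [if_pos hbrZ, tsum_zero]
  · rw [if_neg hbr]
    have hbrZ : ¬ (IsTreeZ L (amb p) ∨ ¬ IsPivZ L (amb p)) := by
      rintro (h | h)
      · exact hbr (Or.inl ((isTree_iff_isTreeZ M hL p).2 h))
      · exact hbr (Or.inr fun h' => h ((mem_faces_iff_isPivZ M hL p).1 h'))
    simp_rw [if_neg hbrZ]
    rw [tsum_neg, tsum_div_const, multP_eq_tsum_mult M _ q.1.2]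
    rfl

/-! ## §5 `Δ_T = per Δ_Z` for the genuine (1.65) operator -/

/-- **the torus matrix of the (1.66) form is the periodisation of road P2's `ℤ^{d+1}` kernel** — the road-P2 chair's `deltaPol_eq_tsum_deltaZ` (p-accepted)
in PART A's notation. [cite: Balaban1984PropagatorsI, (1.66) p.29] [folklore] -/
theorem per_deltaZ [NeZero L] (k : ℕ) : per M (deltaZ L k) = deltaPol M (L ^ k) := by
  ext p q
  rw [per_apply, deltaPol_eq_tsum_deltaZ]
  rfl

/-- **`Δ_T = per Δ_Z` FOR THE GENUINE (1.65) OPERATOR**: pv09's `reDelK (L^k) _ M` (`Re Δ_k` in the bond basis of the torus) is the periodisation of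
road P2's `deltaZ L k` (pv09's junction `deltaPol_eq_reDelK`). [cite: Balaban1984PropagatorsI, (1.65)–(1.66) p.29] [folklore] -/
theorem per_deltaZ_eq_reDelK [NeZero L] (k : ℕ) (h : 1 ≤ L ^ k) : per M (deltaZ L k) = reDelK (L ^ k) h M := by
  rw [per_deltaZ, deltaPol_eq_reDelK]

end Summit.QuantumFields.BalabanUV.Beta.GAN24.ElimPeriodise

end
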